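import Literature.NumberTheory.Sieve.SmoothTwistedSaddleWindowQuant
import Literature.NumberTheory.Sieve.SmoothTwistedSaddleWindow2Decay
import Literature.NumberTheory.Sieve.SmoothTwistedSaddleWindowLongTails
import HarnessLib

/-!
# The twisted saddle point at the scales `x/e`: QUANTITATIVE precision, LONG frequency range

Topic `Literature/NumberTheory/Sieve`; a PROVED file extending `SmoothTwistedSaddleWindowQuant`
([HildebrandTenenbaum1986, §4], [Harper2016, §5]). There, `TwistedWeight.scaledSum_main_term_quant`
evaluates `S_w(λ; x/e) = ∑_{n ∈ S(x/e, y)} W_λ(n/(x/e))` (`W_λ(v) = v²(1−v)²e(λv)`) in the range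
`(log x)^4 ≤ y ≤ exp((log x)^{1/5})`, `1 ≤ e ≤ (log x)^B`, `|λ| ≤ Λ`, as `e^{−α} 𝓜 Ŵ_λ(α)` up to
`e^{−α} C(B+1)² (log y/log x) 𝓜/(1+|λ|)`, under `Λ⁸ ≤ y`. The ONLY source of that restriction is the
cutoff `T ≤ κ√y` of the Perron-type integral, forced by the range `3 ≤ |t| ≤ κ√y` in which the
Chebyshev / Brun–Titchmarsh decay of `ζ(α+it,y)/ζ(α,y)` is available unconditionally
(`TwistedWeight.twist_range`). Here we take the LONG-range decay
`ζ(α+it,y)/ζ(α,y) ≤ exp(−c log x/log y)` for `3 ≤ |t| ≤ y¹²` as a HYPOTHESIS `hD` (it holds under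
GRH, and is supplied by the consumer), and reach `|λ| ≤ Λ ≤ y⁷`:

`scaledSum_main_term_quant_long hD`: there is an absolute `C > 0` such that for every `B : ℕ`, all
`x ≥ x₀(B)`, `(log x)^4 ≤ y ≤ exp((log x)^{1/5})`, `1 ≤ Λ ≤ y⁷`, `1 ≤ e ≤ (log x)^B`, `|λ| ≤ Λ`:
`‖S_w(λ; x/e) − e^{−α} 𝓜 Ŵ_λ(α)‖ ≤ e^{−α} · C (B+1)² (log y/log x) · 𝓜/(1 + |λ|)`,
`𝓜 = x^α ζ(α,y)/√(2π φ₂(α,y))`, `α = α(x,y)`.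

Proof: as for `scaledSum_main_term_quant` (window `W = √(560 r)`, `r = (log x)^{1/5}`, the second
order parametric theorem, `err_midrange_le`, `window_floor_quant`, `window_term_quant`), with the cutoff
`T = Λ^{3/2} log x ≤ y¹²` and two changes in the tails: the far range `2π ε₂ T √φ₂ (1+|λ|)` is
`≤ 8π (log x)² y²¹ exp(−c log x/log y) ≤ 8π/log x` (`long_farrange_le`), and the kernel tail uses the
sharpened decay `‖A_{λ,e}(t)‖ ≤ e^{−α}(2 + 6X + 6X² + X³C_λ/T³)/|t|³` of
`SmoothTwistedSaddleWindow2Decay` (`X = 2π|λ|`), whose constant is `≤ 278Λ²` for `T³ ≥ Λ⁴(log x)³`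
(`long_decayConst_le`), so that `2π · 278Λ² · 2 log x · 2Λ/T² ≤ 7000/log x` (`long_decay_le`); the
bookkeeping of the cutoff and of these two tails is `SmoothTwistedSaddleWindowLongTails`.

## References

* A. J. Harper, Compositio Math. 152 (2016), §5 [Harper2016].
* A. Hildebrand, G. Tenenbaum, Trans. AMS 296 (1986), §4 [HildebrandTenenbaum1986].
-/

noncomputable section

open Real Complex MeasureTheory Set Filter
open scoped FourierTransform Topology

namespace Literature.NumberTheory.Sieve

namespace TwistedWeight

/-! ### The theorem -/

set_option maxHeartbeats 1600000 in
/-- **The twisted smooth sums at the scales `x/e`, `1 ≤ e ≤ (log x)^B`, to relative precision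
`C(B+1)² log y/log x, for frequencies `|λ| ≤ Λ ≤ y⁷`, given the long-range decay of `ζ(α+it,y)/ζ(α,y)`.**
Assume `hD`: for some `c > 0`, all large `x`, `(log x)^4 ≤ y ≤ exp((log x)^{1/5})` and `3 ≤ |t| ≤ y¹²`,
`|ζ(α+it,y)|/ζ(α,y) ≤ exp(−c log x/log y)` (`α = α(x,y)`; a consequence of GRH). Then there is an
absolute constant `C > 0` such that for every `B : ℕ` there is `x₀` with: for `x ≥ x₀`,
`(log x)^4 ≤ y ≤ exp((log x)^{1/5})`, `1 ≤ Λ ≤ y⁷`, `1 ≤ e ≤ (log x)^B` and `|λ| ≤ Λ`, with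
`𝓜 = x^α ζ(α,y)/√(2π φ₂(α,y))`:
`‖∑_{n ∈ S(x/e, y)} (n e/x)²(1−ne/x)² e(λne/x) − e^{−α} 𝓜 Ŵ_λ(α)‖ ≤ e^{−α} C(B+1)² (log y/log x) 𝓜/(1+|λ|)`,
`Ŵ_λ(α) = ∫₀¹ v^{α+1}(1−v)² e(λv) dv`. This is `scaledSum_main_term_quant` with `Λ⁸ ≤ y` replaced by
`Λ ≤ y⁷`: the cutoff is `T = Λ^{3/2} log x ≤ y¹²` (fed by `hD`), the kernel tail uses
`norm_scaledSum_sub_main_le_window₂_decay` with `scaledKernel_decay₂`.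
[cite: HildebrandTenenbaum1986, §4 (Lemmas 10–11)] [cite: Harper2016, §5] -/
theorem scaledSum_main_term_quant_long
    (hD : ∃ c : ℝ, 0 < c ∧ ∃ x₀ : ℝ, ∀ (x : ℝ) (y : ℕ), x₀ ≤ x → Real.log x ^ 4 ≤ (y : ℝ) →
      Real.log (y : ℝ) ≤ Real.log x ^ (1 / 5 : ℝ) →
      ∀ t : ℝ, 3 ≤ |t| → |t| ≤ (y : ℝ) ^ 12 →
        ‖smoothZetaC ((saddlePoint x y : ℂ) + t * I) y‖ / smoothZeta (saddlePoint x y) y ≤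
          Real.exp (-(c * (Real.log x / Real.log (y : ℝ))))) :
    ∃ C : ℝ, 0 < C ∧ ∀ B : ℕ, ∃ x₀ : ℝ, ∀ (x : ℝ) (y : ℕ), x₀ ≤ x → Real.log x ^ 4 ≤ (y : ℝ) →
      Real.log (y : ℝ) ≤ Real.log x ^ (1 / 5 : ℝ) →
      ∀ Λ : ℝ, 1 ≤ Λ → Λ ≤ (y : ℝ) ^ 7 → ∀ e : ℕ, 1 ≤ e → (e : ℝ) ≤ Real.log x ^ B → ∀ lam : ℝ, |lam| ≤ Λ →
      ‖(∑ n ∈ Nat.smoothNumbersUpTo ⌊x / e⌋₊ (y + 1), twistWeight lam (n / (x / e))) -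
          ((((e : ℝ) ^ (-saddlePoint x y) * (x ^ saddlePoint x y * smoothZeta (saddlePoint x y) y /
              Real.sqrt (2 * Real.pi * saddlePhi₂ (saddlePoint x y) y)) : ℝ)) : ℂ) *
            twistMellin lam (saddlePoint x y)‖ ≤
        (e : ℝ) ^ (-saddlePoint x y) * ((C * ((B : ℝ) + 1) ^ 2 * Real.log (y : ℝ) / Real.log x) *
          (x ^ saddlePoint x y * smoothZeta (saddlePoint x y) y /
            Real.sqrt (2 * Real.pi * saddlePhi₂ (saddlePoint x y) y)) / (1 + |lam|)) := by
  obtain ⟨A₂, A₃, κ, c_φ, hA₂, -, -, hc_φ, x₁, hR⟩ := twist_range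
  obtain ⟨c_D, hc_D, x_D, hDec⟩ := hD
  -- the absolute constant
  set a₄ : ℝ := 122 * 10 ^ 7 / A₂ ^ 10 with ha₄
  set a₅ : ℝ := 41 with ha₅
  set a₆ : ℝ := 11200 with ha₆
  set C : ℝ := 500 + 26000000 / c_φ + a₄ + a₅ + a₆ with hC
  have ha₄0 : 0 < a₄ := by positivity
  have ha₅0 : 0 < a₅ := by norm_num
  have ha₆0 : 0 < a₆ := by norm_num
  have hC0 : 0 < C := by positivity
  refine ⟨C, hC0, fun B => ?_⟩
  -- thresholds on `L = log x`
  set qw : ℝ := 169 * 560 ^ 3 / c_φ with hqw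
  have hqw0 : 0 < qw := by positivity
  set m : ℝ := max 1 (36 / c_D) with hm
  set L₁ : ℝ := max (max 64 (qw ^ 5)) (m ^ 5) with hL₁
  refine ⟨max (max x₁ x_D) (Real.exp L₁), fun x y hx hy4 hylog Λ hΛ1 hΛy e he1 heL lam hlam => ?_⟩
  have hx₁ : x₁ ≤ x := le_trans (le_trans (le_max_left _ _) (le_max_left _ _)) hx
  have hx_D : x_D ≤ x := le_trans (le_trans (le_max_right _ _) (le_max_left _ _)) hx
  obtain ⟨hx1, hy2, hα35, hα1, hφ0, hφlo, hφhi, hL16, hℓ11, -, hπℓ, -, hdec1, -, -⟩ :=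
    hR x y hx₁ hy4 hylog
  set α : ℝ := saddlePoint x y with hαdef
  have hα0 : 0 < α := by linarith only [hα35]
  set φ : ℝ := saddlePhi₂ α y with hφdef
  set Φ : ℝ := Real.sqrt φ with hΦ
  have hΦ0 : 0 < Φ := Real.sqrt_pos.2 hφ0
  have hΦsq : Φ ^ 2 = φ := Real.sq_sqrt hφ0.le
  set L : ℝ := Real.log x with hL
  set ℓ : ℝ := Real.log y with hℓ
  set r : ℝ := L ^ (1 / 5 : ℝ) with hr
  have hL0 : 0 < L := by linarith only [hL16]
  have hL1 : 1 ≤ L := by linarith only [hL16]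
  have hℓ0 : 0 < ℓ := by linarith only [hℓ11]
  have hℓ1 : 1 ≤ ℓ := by linarith only [hℓ11]
  have hxexp : Real.exp L₁ ≤ x := le_trans (le_max_right _ _) hx
  have hLL₁ : L₁ ≤ L := by
    have := Real.log_le_log (Real.exp_pos _) hxexp; rwa [Real.log_exp] at this
  have hL64 : 64 ≤ L := le_trans (le_trans (le_max_left _ _) (le_max_left _ _)) hLL₁
  have hLq : qw ^ 5 ≤ L := le_trans (le_trans (le_max_right _ _) (le_max_left _ _)) hLL₁
  have hLm : m ^ 5 ≤ L := le_trans (le_max_right _ _) hLL₁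
  -- `r`
  have hr0 : 0 < r := Real.rpow_pos_of_pos hL0 _
  have hr5 : r ^ 5 = L := by
    rw [hr, ← Real.rpow_natCast, ← Real.rpow_mul hL0.le]; norm_num
  have hr1 : 1 ≤ r := by
    by_contra h; push Not at h
    have : r ^ 5 < 1 := pow_lt_one₀ hr0.le h (by norm_num)
    linarith only [this, hr5, hL16]
  have hpow5 : ∀ {q : ℝ}, 0 ≤ q → q ^ 5 ≤ L → q ≤ r := by
    intro q hq hqL
    by_contra h; push Not at h
    have : r ^ 5 < q ^ 5 := pow_lt_pow_left₀ h hr0.le (by norm_num)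
    linarith only [this, hr5, hqL]
  have hrm : m ≤ r := hpow5 (le_trans zero_le_one (le_max_left _ _)) hLm
  have hrq : qw ≤ r := hpow5 hqw0.le hLq
  have hℓr : ℓ ≤ r := hylog
  have hℓL : ℓ ≤ L := by
    calc ℓ ≤ r := hℓr
      _ = r * 1 := (mul_one r).symm
      _ ≤ r * r ^ 4 := mul_le_mul_of_nonneg_left (one_le_pow₀ hr1) hr0.le
      _ = L := by rw [← hr5]; ring
  have hcDr : 36 ≤ c_D * r := by
    have h1 : 36 / c_D ≤ r := le_trans (le_max_right _ _) hrm
    rw [div_le_iff₀ hc_D] at h1; linarith only [h1]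
  -- `c r ≥ 169·560³`, hence `c r³ ≥ 560`, `c r⁴ ≥ 1`
  have hcr : 169 * 560 ^ 3 ≤ c_φ * r := by
    have := hrq; rw [hqw, div_le_iff₀ hc_φ] at this; linarith only [this]
  have hr3 : r ≤ r ^ 3 := by
    have := pow_le_pow_right₀ hr1 (by norm_num : 1 ≤ 3); rwa [pow_one] at this
  have hr4 : r ≤ r ^ 4 := by
    have := pow_le_pow_right₀ hr1 (by norm_num : 1 ≤ 4); rwa [pow_one] at this
  have hcr3 : 560 ≤ c_φ * r ^ 3 := by
    have h := mul_le_mul_of_nonneg_left hr3 hc_φ.le; linarith only [hcr, h]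
  have hcr4 : 1 ≤ c_φ * r ^ 4 := by
    have h := mul_le_mul_of_nonneg_left hr4 hc_φ.le; linarith only [hcr, h]
  -- the window `W = √(560 r)`
  set W : ℝ := Real.sqrt (560 * r) with hWdef
  have hWsq : W ^ 2 = 560 * r := Real.sq_sqrt (by positivity)
  have hW0 : 0 < W := Real.sqrt_pos.2 (by positivity)
  have hW1 : 1 ≤ W := by
    rw [hWdef, Real.le_sqrt zero_le_one (by positivity)]; linarith only [hr1]
  have hr4Qw : 169 * W ^ 6 / c_φ ≤ r ^ 4 := by
    rw [div_le_iff₀ hc_φ, show W ^ 6 = (W ^ 2) ^ 3 by ring, hWsq]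
    have h := mul_le_mul_of_nonneg_right hcr (pow_nonneg hr0.le 3)
    calc 169 * (560 * r) ^ 3 = 169 * 560 ^ 3 * r ^ 3 := by ring
      _ ≤ c_φ * r * r ^ 3 := h
      _ = r ^ 4 * c_φ := by ring
  -- `log e ≤ B log L ≤ B ℓ/4`
  have he0 : (0 : ℝ) < e := by exact_mod_cast he1
  have hloge0 : 0 ≤ Real.log e := Real.log_nonneg (by exact_mod_cast he1)
  have hlogL : Real.log L ≤ ℓ / 4 := by
    have h1 : Real.log (L ^ 4) ≤ ℓ := Real.log_le_log (by positivity) hy4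
    rw [Real.log_pow] at h1; push_cast at h1; linarith only [h1]
  have hloge : Real.log e ≤ B * ℓ / 4 := by
    have h1 : Real.log e ≤ B * Real.log L := by
      calc Real.log e ≤ Real.log (L ^ B) := Real.log_le_log he0 heL
        _ = B * Real.log L := by rw [Real.log_pow]
    have h3 : (B : ℝ) * Real.log L ≤ B * (ℓ / 4) := mul_le_mul_of_nonneg_left hlogL (Nat.cast_nonneg B)
    linarith only [h1, h3]
  -- `Φ ≤ 2L`, `y > 0`, `ℓ W ≤ Φ`, `ℓ⁴/φ ≤ ℓ²`
  have hΦle : Φ ≤ 2 * L := by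
    rw [hΦ, Real.sqrt_le_left (by positivity)]
    have h1 : L * ℓ ≤ L * L := mul_le_mul_of_nonneg_left hℓL hL0.le
    nlinarith only [hφhi, h1]
  have hy0 : (0 : ℝ) < y := by exact_mod_cast lt_of_lt_of_le two_pos hy2
  have hy1 : (1 : ℝ) ≤ y := by exact_mod_cast le_trans one_le_two hy2
  have hℓW : ℓ * (W / Φ) ≤ 1 := by
    rw [mul_div_assoc', div_le_one hΦ0, hΦ, Real.le_sqrt (by positivity) hφ0.le]
    have h1 : 560 * r * ℓ ≤ c_φ * L := by
      calc 560 * r * ℓ ≤ 560 * r * r := mul_le_mul_of_nonneg_left hℓr (by positivity)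
        _ = 560 * (r * r) := by ring
        _ ≤ c_φ * r ^ 3 * (r * r) := mul_le_mul_of_nonneg_right hcr3 (by positivity)
        _ = c_φ * L := by rw [← hr5]; ring
    calc (ℓ * W) ^ 2 = 560 * r * ℓ * ℓ := by rw [mul_pow, hWsq]; ring
      _ ≤ c_φ * L * ℓ := mul_le_mul_of_nonneg_right h1 hℓ0.le
      _ = c_φ * (L * ℓ) := by ring
      _ ≤ φ := hφlo
  have hℓφ : ℓ ^ 4 / φ ≤ ℓ ^ 2 := by
    rw [div_le_iff₀ hφ0]
    have h1 : ℓ ≤ c_φ * L := by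
      calc ℓ ≤ r := hℓr
        _ = 1 * r := (one_mul r).symm
        _ ≤ c_φ * r ^ 4 * r := mul_le_mul_of_nonneg_right hcr4 hr0.le
        _ = c_φ * L := by rw [← hr5]; ring
    calc ℓ ^ 4 = ℓ ^ 2 * ℓ * ℓ := by ring
      _ ≤ ℓ ^ 2 * (c_φ * L) * ℓ := by gcongr
      _ = ℓ ^ 2 * (c_φ * (L * ℓ)) := by ring
      _ ≤ ℓ ^ 2 * φ := mul_le_mul_of_nonneg_left hφlo (sq_nonneg ℓ)
  -- ### the cutoff `T = Λ^{3/2} L ≤ y¹²` and the long-range decay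
  set T : ℝ := Real.sqrt (Λ ^ 3) * L with hTdef
  obtain ⟨hT3, hT2, hT3pow, hTle⟩ := long_cutoff hΛ1 hL16 hTdef
  have hT0 : 0 < T := by linarith only [hT3]
  have hΛ0 : 0 < Λ := by linarith only [hΛ1]
  have hTy : T ≤ (y : ℝ) ^ 12 := long_cutoff_le hΛ0.le hΛy hL1 hy4 hy1 hT2
  set ε₂ : ℝ := Real.exp (-(c_D * (L / ℓ))) with hε₂
  have hdec2 : ∀ t : ℝ, 3 ≤ |t| → |t| ≤ T →
      ‖smoothZetaC ((α : ℂ) + t * I) y‖ / smoothZeta α y ≤ ε₂ := fun t ht1 ht2 =>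
    hDec x y hx_D hy4 hylog t ht1 (ht2.trans hTy)
  -- the sharpened kernel tail
  set N : ℝ := 2 + 6 * (2 * π * |lam|) + 6 * (2 * π * |lam|) ^ 2 + (2 * π * |lam|) ^ 3 *
      ((2 + 6 * (2 * π * |lam|) + 6 * (2 * π * |lam|) ^ 2 + (2 * π * |lam|) ^ 3) / T ^ 3) with hN
  have hN0 : 0 ≤ N := by rw [hN]; have := Real.pi_pos; positivity
  have hB3 : ∀ t : ℝ, T < |t| → ‖scaledKernel α e lam t‖ ≤ (e : ℝ) ^ (-α) * N / |t| ^ 3 := fun t ht =>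
    scaledKernel_decay₂ hα0 he1 lam hT3 ht
  -- ### the window `W/Φ` is admissible, apply the second-order parametric theorem
  obtain ⟨-, hτ, -⟩ := SaddleKernel.window_range hc_φ hW1 hℓ0 hr0 hr5 hℓr hφlo hr4Qw
  have hη₂ := SaddleKernel.window_range₂ hc_φ hW1 hℓ0 hr0 hr5 hℓr hφlo hr4Qw
    (saddlePhi₃_le_mul_saddlePhi₂ hα35 y) (saddlePhi₄_le_mul_saddlePhi₂ hα35 y)
  have hmain := norm_scaledSum_sub_main_le_window₂_decay hx1 hy2 hα35 hα1 hφ0 hW0 hτ hπℓ hη₂ hT3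
    (Real.exp_pos _).le (Real.exp_pos _).le hdec1 hdec2 he1 lam hN0 hB3
  rw [← hφdef] at hmain
  rw [← hℓ] at hmain
  rw [← hαdef] at hmain
  rw [← hΦ] at hmain
  refine hmain.trans ?_
  -- ### the main constant: `c = 𝓜 Φ/√(2π)`
  set M : ℝ := x ^ α * smoothZeta α y / Real.sqrt (2 * Real.pi * φ) with hM
  set ρ : ℝ := (e : ℝ) ^ (-α) with hρ
  have hρ0 : 0 < ρ := Real.rpow_pos_of_pos he0 _
  have hζ0 : 0 < smoothZeta α y := smoothZeta_pos hα0
  have hx0 : 0 < x := by linarith only [hx1]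
  have hM0 : 0 < M := by rw [hM]; have := Real.pi_pos; positivity
  have hs2π : (5 / 2 : ℝ) ≤ Real.sqrt (2 * Real.pi) := by
    rw [Real.le_sqrt (by norm_num) (by positivity)]; have := Real.pi_gt_d2; norm_num; linarith
  have hs2π0 : 0 < Real.sqrt (2 * Real.pi) := by linarith only [hs2π]
  have hc : x ^ α * smoothZeta α y / (2 * Real.pi) = M * Φ / Real.sqrt (2 * Real.pi) := by
    have e' := SaddleKernel.main_const_identity hφ0 (x ^ α * smoothZeta α y)
    rw [← hM, Real.sqrt_div' _ hφ0.le, ← hΦ] at e'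
    rw [← e']
    field_simp
  rw [hc]
  -- the target precision `η = C (B+1)² ℓ/L`, `P = (B+1)² ℓ ≥ 1`
  set P : ℝ := ((B : ℝ) + 1) ^ 2 * ℓ with hP
  have hB0 : (0 : ℝ) ≤ B := Nat.cast_nonneg B
  have hP1 : 1 ≤ P := by
    rw [hP]; exact one_le_mul_of_one_le_of_one_le (one_le_pow₀ (by linarith only [hB0])) hℓ1
  set η : ℝ := C * ((B : ℝ) + 1) ^ 2 * ℓ / L with hη
  have hηP : η = C * P / L := by rw [hη, hP]; ring
  have hη0 : 0 ≤ η := by rw [hηP]; positivity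
  -- ### it suffices to bound `bracket · Φ · (1+|λ|) ≤ (5/2) η`
  set X : ℝ := 2 * (Real.log e + 3) ^ 2 + (2 + 2 * Real.log e) * (15 * ℓ + 666 * ℓ ^ 2 * (W / Φ)) +
      916 * ℓ ^ 2 + 7000000 * ℓ ^ 4 / φ with hX
  set Br : ℝ := 2 / (1 + |lam|) * (Real.exp (-(W ^ 2 / 4)) * Real.sqrt (4 * Real.pi / φ)) +
      Real.sqrt (4 * Real.pi / φ) * (X / (φ * (1 + |lam|))) +
      ((2 / (1 + |lam|)) * Real.exp (-(W ^ 2 / 140)) * Real.sqrt (125 * Real.pi ^ 3 / φ) +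
        20 * Real.pi * Real.exp (-(A₂ * r)) / (α * (1 + |lam|)) +
        2 * Real.pi * ε₂ * T + 2 * Real.pi * N / T ^ 2) with hBr
  have hlam0 : 0 < 1 + |lam| := by positivity
  suffices hkey : Br * Φ * (1 + |lam|) ≤ 5 / 2 * η by
    have h1 : M * Φ / Real.sqrt (2 * Real.pi) * ρ * Br =
        ρ * ((Br * Φ * (1 + |lam|)) * (M / (Real.sqrt (2 * Real.pi) * (1 + |lam|)))) := by
      field_simp
    rw [h1]
    apply mul_le_mul_of_nonneg_left _ hρ0.le
    have hq0 : 0 ≤ M / (Real.sqrt (2 * Real.pi) * (1 + |lam|)) := by positivity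
    calc Br * Φ * (1 + |lam|) * (M / (Real.sqrt (2 * Real.pi) * (1 + |lam|)))
        ≤ 5 / 2 * η * (M / (Real.sqrt (2 * Real.pi) * (1 + |lam|))) := mul_le_mul_of_nonneg_right hkey hq0
      _ = η * M / (1 + |lam|) * ((5 / 2) / Real.sqrt (2 * Real.pi)) := by
          field_simp
      _ ≤ η * M / (1 + |lam|) * 1 := by
          apply mul_le_mul_of_nonneg_left _ (by positivity)
          rw [div_le_one hs2π0]; exact hs2π
      _ = η * M / (1 + |lam|) := mul_one _
  -- ### expand `Br Φ (1+|λ|)` into six terms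
  have hexpand : Br * Φ * (1 + |lam|) =
      2 * Real.exp (-(W ^ 2 / 4)) * (Real.sqrt (4 * Real.pi / φ) * Φ) +
      (Real.sqrt (4 * Real.pi / φ) * Φ) * X / φ +
      2 * Real.exp (-(W ^ 2 / 140)) * (Real.sqrt (125 * Real.pi ^ 3 / φ) * Φ) +
      20 * Real.pi * Real.exp (-(A₂ * r)) * Φ / α +
      2 * Real.pi * ε₂ * T * Φ * (1 + |lam|) +
      2 * Real.pi * N / T ^ 2 * Φ * (1 + |lam|) := by
    rw [hBr]
    field_simp
    ring
  rw [hexpand]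
  -- `√(4π/φ) Φ = √(4π)`, `√(125π³/φ) Φ = √(125 π³)`
  have hsq1 : Real.sqrt (4 * Real.pi / φ) * Φ = Real.sqrt (4 * Real.pi) := by
    rw [Real.sqrt_div' _ hφ0.le, hΦ]; field_simp
  have hsq2 : Real.sqrt (125 * Real.pi ^ 3 / φ) * Φ = Real.sqrt (125 * Real.pi ^ 3) := by
    rw [Real.sqrt_div' _ hφ0.le, hΦ]; field_simp
  rw [hsq1, hsq2]
  -- ### the six terms
  have hTac : 2 * Real.exp (-(W ^ 2 / 4)) * Real.sqrt (4 * Real.pi) +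
      2 * Real.exp (-(W ^ 2 / 140)) * Real.sqrt (125 * Real.pi ^ 3) ≤ 464 / L :=
    window_floor_quant hr0 hr5 hL1 hWsq
  have hXle : X ≤ 7100000 * ((B : ℝ) + 1) ^ 2 * ℓ ^ 2 :=
    window_term_quant hloge0 hloge hB0 hℓ1 hℓW hℓφ
  have hTb : Real.sqrt (4 * Real.pi) * X / φ ≤ 26000000 / c_φ * P / L := by
    have hs4π : Real.sqrt (4 * Real.pi) ≤ 18 / 5 := by
      rw [Real.sqrt_le_left (by norm_num)]; have := Real.pi_lt_d2; norm_num; linarith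
    have hX0 : 0 ≤ X := by rw [hX]; positivity
    have hφlo' : c_φ * (L * ℓ) ≤ φ := hφlo
    calc Real.sqrt (4 * Real.pi) * X / φ ≤ (18 / 5) * (7100000 * ((B : ℝ) + 1) ^ 2 * ℓ ^ 2) / (c_φ * (L * ℓ)) := by
          have hnum : Real.sqrt (4 * Real.pi) * X ≤ (18 / 5) * (7100000 * ((B : ℝ) + 1) ^ 2 * ℓ ^ 2) :=
            mul_le_mul hs4π hXle hX0 (by norm_num)
          exact div_le_div₀ (by positivity) hnum (by positivity) hφlo'
      _ = 25560000 / c_φ * P / L := by rw [hP]; field_simp; ring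
      _ ≤ 26000000 / c_φ * P / L := by gcongr; norm_num
  -- the three tail terms with `δ ∝ 1/L`
  have hδ₄ : 0 < a₄ / L := by positivity
  have hT4 : 20 * Real.pi * Real.exp (-(A₂ * r)) * Φ / α ≤ 5 / 8 * (a₄ / L) := by
    refine err_midrange_le hA₂ hδ₄ hr0 hr5 hΦ0.le hΦle hα35 (le_of_eq ?_)
    rw [ha₄]; field_simp
  have hT5 : 2 * Real.pi * ε₂ * T * Φ * (1 + |lam|) ≤ 5 / 8 * (a₅ / L) :=
    long_farrange_le hc_D hr1 hr5 hcDr hℓ0 hℓr hΦ0.le hΦle hΛ1 hlam (Real.exp_log hy0).symm hΛy hT0.le hTle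
  have hT6 : 2 * Real.pi * N / T ^ 2 * Φ * (1 + |lam|) ≤ 5 / 8 * (a₆ / L) :=
    long_decay_le hΛ1 hlam hL64 hT0 hT2 hT3pow hΦ0.le hΦle
  -- ### collect: everything is `≤ C P/L ≤ (5/2) η`
  have i1 : 464 / L ≤ 500 * P / L := by
    apply div_le_div_of_nonneg_right _ hL0.le; linarith only [hP1]
  have iP : ∀ {a : ℝ}, 0 < a → 5 / 8 * (a / L) ≤ a * P / L := by
    intro a ha
    rw [show 5 / 8 * (a / L) = (5 / 8 * a) / L by ring]
    apply div_le_div_of_nonneg_right _ hL0.le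
    have := mul_le_mul_of_nonneg_left hP1 ha.le
    linarith only [this, ha]
  have hsum : 464 / L + 26000000 / c_φ * P / L + 5 / 8 * (a₄ / L) + 5 / 8 * (a₅ / L) + 5 / 8 * (a₆ / L) ≤
      C * P / L := by
    have e1 : C * P / L = 500 * P / L + 26000000 / c_φ * P / L + a₄ * P / L + a₅ * P / L + a₆ * P / L := by
      rw [hC]; ring
    rw [e1]
    linarith only [i1, iP ha₄0, iP ha₅0, iP ha₆0]
  have hfin : C * P / L ≤ 5 / 2 * η := by
    rw [hηP]
    have : 0 ≤ C * P / L := by positivity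
    linarith
  linarith [hTac, hTb, hT4, hT5, hT6, hsum, hfin]

end TwistedWeight

end Literature.NumberTheory.Sieve

end
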